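import Literature.NumberTheory.EllipticCurves.Tian2014.CMPointSystemRationality
import HarnessLib

/-!
# The signed Heegner points `y_{d,φ} = Σ_φ χ_d(t) z_t` (Tian (4.5) = journal (4.6) with the genus character;
# Monsky's `S_{N,φ} = Σ_φ ε_𝒜 P_𝒜`, Def. 4.4) and Monsky Thm. 4.7 for the second twist `ℚ(√−d)`

Cell `bsd-monsky` (typer seat), kernel work K1 second half: the character `χ_d(t) = ±1` ("`ε_𝒜 = 1` or `−1` according
as `𝒜 ∈ G_N` or not"), its multiplicativity, the signed transversal-change rule (Remark p. 57), the Galois actions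
`σ_s(y) = χ(s)·y_{sφ}`, `τ(y) = y + Σ_φ (0,0)`, `conj(y) = −y_{φ⁻¹} + Σ_φ (1,0)`, the subgroup of automorphisms acting
"through the sign of `√−d`" (`twistStabilizer`), and the descent: for a `B`-stable transversal, and then for every
transversal, `y_{d,φ}` is the transfer along `√−d` of a rational point of `E_d` ("`S_N ∈ Λ_N`", Thm. 4.7 for `N = D`
resp. `N = p₇`). Nothing asserted.
[cite: Monsky1990MockHeegner, Def. 4.4 (p. 56), Remark (p. 57), Thm. 4.5 (p. 57), Thm. 4.7 (pp. 57–58), Lemma 4.1 (p. 56)]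
[cite: Tian2014, §4.2 (p0022 L77–L96), (4.8) (p0023 L46–L50)]
-/

noncomputable section

open scoped Classical

open WeierstrassCurve NumberField Literature.NumberTheory.EllipticCurves
  Literature.NumberTheory.EllipticCurves.TianYuanZhang2017 Literature.GroupTheory.FiniteAbelian

namespace Literature.NumberTheory.EllipticCurves.Tian2014

/-! ## §K1.e The signed sums `y_{d,φ} = Σ χ_d(t) z_t` (Tian (4.5) with the genus character `χ_d`; Monsky's `S_{N,φ}`
with `ε_𝒜 = ±1`) and their Galois-twisted rationality over `ℚ(√−d)` — Monsky Thm. 4.7 for the second twist -/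

namespace CMPointData

variable {n : ℕ}

/-- The genus character `χ` attached to a square root `θ′` (of a rational number) in `H`: `χ(t) = ±1` according
as `σ_t` fixes or moves `θ′` (Tian: "`χ = χ_d` the character of `𝒜` … factoring through `Gal(K(i,√−d)/K(i))`";
Monsky: "`ε_𝒜 = 1` or `−1` according as `𝒜 ∈ G_N` or `𝒜 ∉ G_N`"). [cite: Tian2014, §4.2 (p0022 L77–L83)] [cite: Monsky1990MockHeegner, Def. 4.4 (p. 56)] -/
def chi (D : CMPointData n) (θ' : D.H) (t : ClassGroup (𝓞 (GenusField (2 * n)))) : ℤ :=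
  if D.art t θ' = θ' then 1 else -1

/-- **The signed Heegner point `y_{d,φ} = Σ_{t∈φ} χ_d(t) z_t`** ((4.5) = journal (4.6)); Monsky's `S_{N,φ} = Σ_φ ε_𝒜 P_𝒜`.
[cite: Tian2014, (4.5) (p0022 L84–L89)] [cite: Monsky1990MockHeegner, Def. 4.4 (p. 56)] -/
def yPointChi (D : CMPointData n) (θ' : D.H) (φ : Finset (ClassGroup (𝓞 (GenusField (2 * n))))) : EPoint D.H :=
  ∑ t ∈ φ, D.chi θ' t • D.z t

/-- `χ(t) = ±1`. [cite: Monsky1990MockHeegner, Def. 4.4 (p. 56: ε_𝒜 = 1 or −1)] [folklore] -/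
theorem chi_eq_one_or_neg_one (D : CMPointData n) (θ' : D.H) (t : ClassGroup (𝓞 (GenusField (2 * n)))) :
    D.chi θ' t = 1 ∨ D.chi θ' t = -1 := by
  unfold chi; split_ifs <;> simp

/-- `χ(t)·ε = ε` for a `2`-torsion point `ε`. [cite: Monsky1990MockHeegner, Remark (p. 57: "ε_{m𝒜} = ε_𝒜 and P_{m𝒜} − P_𝒜 ∈ T")] [folklore] -/
theorem chi_smul_of_two_nsmul_eq_zero (D : CMPointData n) (θ' : D.H) (t : ClassGroup (𝓞 (GenusField (2 * n))))
    {ε : EPoint D.H} (hε : (2 : ℕ) • ε = 0) : D.chi θ' t • ε = ε := by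
  rcases D.chi_eq_one_or_neg_one θ' t with h | h <;> rw [h]
  · exact one_zsmul ε
  · rw [neg_one_zsmul, neg_eq_iff_add_eq_zero, ← two_nsmul]; exact hε

section Character

variable (D : CMPointData n) {θ' : D.H} {c : ℚ} (hθ' : θ' ^ 2 = algebraMap ℚ D.H c)

include hθ'

/-- Every automorphism sends `θ′` to `±θ′` (`θ′²` rational). [cite: Monsky1990MockHeegner, Thm. 4.5 proof (p. 57: "according as σ fixes or moves √N")] [folklore] -/
theorem gal_theta'_eq_or_eq_neg (g : D.H ≃ₐ[ℚ] D.H) : g θ' = θ' ∨ g θ' = -θ' := by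
  have : (g θ') ^ 2 = θ' ^ 2 := by rw [← map_pow, hθ', AlgEquiv.commutes]
  exact sq_eq_sq_iff_eq_or_eq_neg.mp this

/-- `χ` is multiplicative. [cite: Tian2014, §4.2 (p0022 L77–L83: χ a character of 𝒜)] -/
theorem chi_mul (s t : ClassGroup (𝓞 (GenusField (2 * n)))) :
    D.chi θ' (s * t) = D.chi θ' s * D.chi θ' t := by
  unfold chi
  rw [map_mul, AlgEquiv.mul_apply]
  rcases D.gal_theta'_eq_or_eq_neg hθ' (D.art t) with ht | ht <;>
    rcases D.gal_theta'_eq_or_eq_neg hθ' (D.art s) with hs | hs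
  · rw [ht, hs]; simp
  · rw [ht, hs]; simp
  · rw [ht, map_neg, hs]; split_ifs <;> simp_all
  · rw [ht, map_neg, hs, neg_neg]; split_ifs <;> simp_all

omit hθ' in
/-- `χ(1) = 1`. [cite: Tian2014, §4.2 (p0022 L77–L83: χ a character of 𝒜)] [folklore] -/
theorem chi_one : D.chi θ' 1 = 1 := by
  unfold chi; rw [map_one]; simp

/-- `χ(t⁻¹) = χ(t)`. [cite: Tian2014, §4.2 (p0022 L77–L83: χ a character of 𝒜)] [folklore] -/
theorem chi_inv (t : ClassGroup (𝓞 (GenusField (2 * n)))) : D.chi θ' t⁻¹ = D.chi θ' t := by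
  have h := D.chi_mul hθ' t⁻¹ t
  rw [inv_mul_cancel, D.chi_one] at h
  rcases D.chi_eq_one_or_neg_one θ' t with h1 | h1 <;>
    rcases D.chi_eq_one_or_neg_one θ' t⁻¹ with h2 | h2 <;> simp_all

end Character

section SignedSums

variable (D : CMPointData n) {θ' : D.H} {c : ℚ} (hθ' : θ' ^ 2 = algebraMap ℚ D.H c)
  (hπθ' : D.art D.piPrime θ' = θ')

include hθ' hπθ'

/-- `χ([ϖ′]t) = χ(t)` ("`ε_{m𝒜} = ε_𝒜`", Monsky Remark p. 57; `m ∈ G_N`, Lemma 4.1). [cite: Monsky1990MockHeegner, Lemma 4.1 (p. 56), Remark (p. 57)] -/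
theorem chi_piPrime_mul (t : ClassGroup (𝓞 (GenusField (2 * n)))) :
    D.chi θ' (D.piPrime * t) = D.chi θ' t := by
  rw [D.chi_mul hθ']
  have : D.chi θ' D.piPrime = 1 := by unfold chi; rw [hπθ']; simp
  rw [this, one_mul]

/-- **Changing the transversal, signed form**: `y_{d,φ′} = y_{d,φ} + Σ_{t ∈ φ ∖ φ′} (±1, 0)` (Monsky Remark p. 57:
"changing the set of representatives translates `S_{N,φ}` by an element of `T`"). [cite: Monsky1990MockHeegner, Remark (p. 57)] [cite: Tian2014, §4.2 (p0022 L89–L94)] -/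
theorem yPointChi_eq_add_sum_of_isReps (h3 : D.thm28_3) (hπ : D.piPrime * D.piPrime = 1)
    {φ φ' : Finset (ClassGroup (𝓞 (GenusField (2 * n))))} (hφ : D.IsRepsModPiPrime φ)
    (hφ' : D.IsRepsModPiPrime φ') :
    D.yPointChi θ' φ' = D.yPointChi θ' φ +
      ∑ _t ∈ φ.filter (fun t => t ∉ φ'), (if n % 8 = 7 then ptOne else ptNegOne : EPoint D.H) := by
  classical
  set ε : EPoint D.H := if n % 8 = 7 then ptOne else ptNegOne with hε
  have hε2 : (2 : ℕ) • ε = 0 := by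
    rw [hε]; split_ifs
    · exact two_nsmul_ptOne
    · exact two_nsmul_ptNegOne
  have hshift : ∀ t, D.z (D.piPrime * t) = D.z t + ε := by
    intro t
    have := h3 t
    rw [sub_eq_iff_eq_add] at this
    rw [this, hε, add_comm]
  have hsplit' : D.yPointChi θ' φ' = (∑ t ∈ φ' with t ∈ φ, D.chi θ' t • D.z t) +
      ∑ t ∈ φ' with t ∉ φ, D.chi θ' t • D.z t := by
    rw [yPointChi, ← Finset.sum_filter_add_sum_filter_not φ' (fun t => t ∈ φ)]
  have hsplit : D.yPointChi θ' φ = (∑ t ∈ φ with t ∈ φ', D.chi θ' t • D.z t) +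
      ∑ t ∈ φ with t ∉ φ', D.chi θ' t • D.z t := by
    rw [yPointChi, ← Finset.sum_filter_add_sum_filter_not φ (fun t => t ∈ φ')]
  have hcommon : (∑ t ∈ φ' with t ∈ φ, D.chi θ' t • D.z t) = ∑ t ∈ φ with t ∈ φ', D.chi θ' t • D.z t := by
    congr 1
    ext t; simp [and_comm]
  have himage : (φ'.filter fun t => t ∉ φ) = (φ.filter fun t => t ∉ φ').image (fun t => D.piPrime * t) := by
    ext t
    simp only [Finset.mem_filter, Finset.mem_image]
    constructor
    · rintro ⟨ht', ht⟩
      refine ⟨D.piPrime * t, ⟨?_, ?_⟩, ?_⟩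
      · rcases hφ t with ⟨h, -⟩ | ⟨h, -⟩
        · exact absurd h ht
        · exact h
      · intro h
        rcases hφ' t with ⟨-, h'⟩ | ⟨-, h'⟩
        · exact h' h
        · exact h' ht'
      · rw [← mul_assoc, hπ, one_mul]
    · rintro ⟨u, ⟨hu, hu'⟩, rfl⟩
      refine ⟨?_, ?_⟩
      · rcases hφ' u with ⟨h, -⟩ | ⟨h, -⟩
        · exact absurd h hu'
        · exact h
      · intro h
        rcases hφ u with ⟨-, h'⟩ | ⟨-, h'⟩
        · exact h' h
        · exact h' hu
  have hinj : Set.InjOn (fun t => D.piPrime * t) ↑(φ.filter fun t => t ∉ φ') := by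
    intro a _ b _ hab
    exact mul_left_cancel hab
  have hterm : ∀ t, D.chi θ' (D.piPrime * t) • D.z (D.piPrime * t) = D.chi θ' t • D.z t + ε := by
    intro t
    rw [D.chi_piPrime_mul hθ' hπθ', hshift, smul_add, D.chi_smul_of_two_nsmul_eq_zero θ' t hε2]
  have hrest : (∑ t ∈ φ' with t ∉ φ, D.chi θ' t • D.z t) = (∑ t ∈ φ with t ∉ φ', D.chi θ' t • D.z t) +
      ∑ _t ∈ φ.filter (fun t => t ∉ φ'), ε := by
    rw [himage, Finset.sum_image hinj, Finset.sum_congr rfl (fun t _ => hterm t), Finset.sum_add_distrib]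
  rw [hsplit', hsplit, hcommon, hrest, add_assoc]

/-- `y_{d,φ}` does not depend on the `B`-stable transversal `φ`. [cite: Monsky1990MockHeegner, Thm. 4.7 proof (pp. 57–58)] -/
theorem yPointChi_eq_of_isReps_of_isStableUnder (h3 : D.thm28_3) (hπ : D.piPrime * D.piPrime = 1)
    {B : ClassGroup (𝓞 (GenusField (2 * n)))} (hB2 : B * B = 1) (hB1 : B ≠ 1)
    {φ φ' : Finset (ClassGroup (𝓞 (GenusField (2 * n))))} (hφ : D.IsRepsModPiPrime φ)
    (hφ' : D.IsRepsModPiPrime φ') (hs : IsStableUnder B φ) (hs' : IsStableUnder B φ') :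
    D.yPointChi θ' φ' = D.yPointChi θ' φ := by
  classical
  rw [D.yPointChi_eq_add_sum_of_isReps hθ' hπθ' h3 hπ hφ hφ',
    sum_const_eq_zero_of_stable hB2 hB1 (isStableUnder_filter_not_mem hB2 hs hs'), add_zero]
  split_ifs
  · rw [← two_nsmul]; exact two_nsmul_ptOne
  · rw [← two_nsmul]; exact two_nsmul_ptNegOne

omit hπθ' in
/-- `σ_s` acts on `y_{d,φ}` through `χ(s)` and a change of transversal: `σ_s(y_{d,φ}) = χ(s)·y_{d,sφ}` (Tian (4.8) =
journal (4.9); Monsky Thm. 4.5 proof: "`σ` maps `S_{N,φ}` to `ε_J·S_{N,J⁻¹φ}`"). [cite: Tian2014, (4.8) (p0023 L46–L50)] [cite: Monsky1990MockHeegner, Thm. 4.5 proof (p. 57)] -/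
theorem act_art_yPointChi (h48 : D.eq48) (s : ClassGroup (𝓞 (GenusField (2 * n))))
    (φ : Finset (ClassGroup (𝓞 (GenusField (2 * n))))) :
    D.act (D.art s) (D.yPointChi θ' φ) = D.chi θ' s • D.yPointChi θ' (φ.image (fun t => s * t)) := by
  classical
  rw [yPointChi, map_sum, yPointChi, Finset.sum_image (fun a _ b _ hab => mul_left_cancel hab), Finset.smul_sum]
  refine Finset.sum_congr rfl (fun t _ => ?_)
  rw [map_zsmul, h48 s t, smul_smul, D.chi_mul hθ', ← mul_assoc]
  have hs2 : D.chi θ' s * D.chi θ' s = 1 := by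
    rcases D.chi_eq_one_or_neg_one θ' s with h | h <;> rw [h] <;> norm_num
  rw [hs2, one_mul]

omit hθ' hπθ' in
/-- `σ_{1+ϖ}(y_{d,φ}) = y_{d,φ} + Σ_φ (0,0)`. [cite: Tian2014, Thm. 2.8 (1) (p0011 L39–L40), (4.6) (p0023 L33–L36)] -/
theorem act_tau_yPointChi (h1 : D.thm28_1) (φ : Finset (ClassGroup (𝓞 (GenusField (2 * n))))) :
    D.act D.tau (D.yPointChi θ' φ) = D.yPointChi θ' φ + ∑ _t ∈ φ, (ptZero : EPoint D.H) := by
  rw [yPointChi, map_sum, ← Finset.sum_add_distrib]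
  refine Finset.sum_congr rfl (fun t _ => ?_)
  rw [map_zsmul, h1 t, smul_add, D.chi_smul_of_two_nsmul_eq_zero θ' t two_nsmul_ptZero]

omit hπθ' in
/-- Complex conjugation: `conj(y_{d,φ}) = −y_{d,φ⁻¹} + Σ_φ (1,0)`. [cite: Tian2014, Thm. 2.8 (2) (p0011 L41), (4.7) (p0023 L39–L41)] -/
theorem act_conj_yPointChi (h2 : D.thm28_2) (φ : Finset (ClassGroup (𝓞 (GenusField (2 * n))))) :
    D.act D.conj (D.yPointChi θ' φ) =
      -D.yPointChi θ' (φ.image (fun t => t⁻¹)) + ∑ _t ∈ φ, (ptOne : EPoint D.H) := by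
  classical
  rw [yPointChi, map_sum, yPointChi, Finset.sum_image (fun a _ b _ hab => inv_injective hab),
    ← Finset.sum_neg_distrib, ← Finset.sum_add_distrib]
  refine Finset.sum_congr rfl (fun t _ => ?_)
  rw [map_zsmul, h2 t, smul_add, D.chi_smul_of_two_nsmul_eq_zero θ' t two_nsmul_ptOne, D.chi_inv hθ',
    smul_neg]

end SignedSums

section TwistDescent

variable (D : CMPointData n) {θ' : D.H} {c : ℚ} (hθ' : θ' ^ 2 = algebraMap ℚ D.H c) (hθ'0 : θ' ≠ 0)

include hθ' hθ'0

/-- The automorphisms that act on a point `y` "through the sign of `θ′`" form a subgroup. [cite: Monsky1990MockHeegner, Thm. 4.7 proof (p. 58: "σ(S_N) = S_N or −S_N according as σ fixes or moves √N")] [folklore] -/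
def twistStabilizer (y : EPoint D.H) : Subgroup (D.H ≃ₐ[ℚ] D.H) where
  carrier := {g | (g θ' = θ' → D.act g y = y) ∧ (g θ' = -θ' → D.act g y = -y)}
  one_mem' := ⟨fun _ => D.act_one y, fun h => by
    rw [AlgEquiv.one_apply] at h
    exact absurd h (by
      intro h'
      have h2 : (2 : D.H) * θ' = 0 := by linear_combination h'
      rcases mul_eq_zero.mp h2 with h3 | h3
      · exact two_ne_zero h3
      · exact hθ'0 h3)⟩
  mul_mem' := by
    rintro g₁ g₂ ⟨h₁f, h₁n⟩ ⟨h₂f, h₂n⟩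
    have hne : -θ' ≠ θ' := by
      intro h'
      have h2 : (2 : D.H) * θ' = 0 := by linear_combination -h'
      rcases mul_eq_zero.mp h2 with h3 | h3
      · exact two_ne_zero h3
      · exact hθ'0 h3
    refine ⟨fun h => ?_, fun h => ?_⟩
    · rw [AlgEquiv.mul_apply] at h
      rw [D.act_mul]
      rcases D.gal_theta'_eq_or_eq_neg hθ' g₂ with h2 | h2
      · rw [h2] at h; rw [h₂f h2, h₁f h]
      · rw [h2, map_neg] at h
        rw [h₂n h2, map_neg, h₁n (neg_eq_iff_eq_neg.mp h), neg_neg]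
    · rw [AlgEquiv.mul_apply] at h
      rw [D.act_mul]
      rcases D.gal_theta'_eq_or_eq_neg hθ' g₂ with h2 | h2
      · rw [h2] at h; rw [h₂f h2, h₁n h]
      · rw [h2, map_neg] at h
        rw [h₂n h2, map_neg, h₁f (neg_inj.mp h)]
  inv_mem' := by
    rintro g ⟨hf, hn⟩
    refine ⟨fun h => ?_, fun h => ?_⟩
    · have h' : g θ' = θ' := by
        have := congrArg g h
        rw [← AlgEquiv.mul_apply, mul_inv_cancel, AlgEquiv.one_apply] at this
        exact this.symm
      have := hf h'
      have h'' := congrArg (D.act g⁻¹) this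
      rw [← D.act_mul, inv_mul_cancel, D.act_one] at h''
      exact h''.symm
    · have h' : g θ' = -θ' := by
        have := congrArg g h
        rw [← AlgEquiv.mul_apply, mul_inv_cancel, AlgEquiv.one_apply, map_neg] at this
        exact neg_eq_iff_eq_neg.mp this.symm
      have := hn h'
      have h'' := congrArg (D.act g⁻¹) this
      rw [← D.act_mul, inv_mul_cancel, D.act_one, map_neg] at h''
      exact neg_eq_iff_eq_neg.mp h''.symm


/-- **Monsky Thm. 4.7 for the twist by `θ′`, signed sums** (CLAIM (4.7-T) of L2-38 §6 for a divisor `d`): for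
`θ′ = √−d ∈ H` fixed by `σ_{[ϖ′]}` (Lemma 4.1: `m ∈ G_N`) and by `σ_{1+ϖ}` (trivial on `H ∋ √−d`) and negated by
complex conjugation, and a `B`-stable transversal `φ`, the signed sum `y_{d,φ} = Σ_φ χ_d(t) z_t` is the transfer
(along `θ′`) of a rational point of `E_d` — "`S_{N,φ} ∈ Λ_N`". Galois bookkeeping: `σ_s(y) = χ(s)y`, `τ(y) = y`,
`conj(y) = −y`, hence `g(y) = ±y` according as `g` fixes or moves `θ′` (the subgroup `twistStabilizer`), and Galois
descent (`exists_transferE_eq_of_forall_gal`). [cite: Monsky1990MockHeegner, Thm. 4.7 (pp. 57–58), Thm. 4.5 proof (p. 57)]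
[cite: Tian2014, Prop. 4.6 proof (p0023 L26–L45)] -/
theorem exists_transferE_eq_yPointChi_of_isStableUnder (hP : D.Printed) (d : ℕ)
    (hθ'd : θ' ^ 2 = algebraMap ℚ D.H (-(d : ℚ))) (hπθ' : D.art D.piPrime θ' = θ') (hτθ' : D.tau θ' = θ')
    (hcθ' : D.conj θ' = -θ') {B : ClassGroup (𝓞 (GenusField (2 * n)))} (hB2 : B * B = 1) (hB1 : B ≠ 1)
    {φ : Finset (ClassGroup (𝓞 (GenusField (2 * n))))} (hφ : D.IsRepsModPiPrime φ) (hs : IsStableUnder B φ) :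
    ∃ y' : (congruentNumberCurve d).toAffine.Point, transferE d θ' hθ'd hθ'0 y' = D.yPointChi θ' φ := by
  classical
  obtain ⟨h1, h2, h3, h48, hart, ⟨htaui, htauθ, htau2⟩, ⟨hconji, hconjθ, hconj2⟩, -, hgalK, hπ, -⟩ := hP
  have hne : -θ' ≠ θ' := by
    intro h'
    have h2' : (2 : D.H) * θ' = 0 := by linear_combination -h'
    rcases mul_eq_zero.mp h2' with h3' | h3'
    · exact two_ne_zero h3'
    · exact hθ'0 h3'
  set y : EPoint D.H := D.yPointChi θ' φ with hy
  -- the three generators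
  have htau : D.act D.tau y = y := by
    rw [hy, D.act_tau_yPointChi h1,
      sum_const_eq_zero_of_stable hB2 hB1 hs (by rw [← two_nsmul]; exact two_nsmul_ptZero), add_zero]
  have hσ : ∀ s, D.act (D.art s) y = D.chi θ' s • y := by
    intro s
    rw [hy, D.act_art_yPointChi hθ' h48, D.yPointChi_eq_of_isReps_of_isStableUnder hθ' hπθ' h3 hπ hB2 hB1 hφ
      (D.isRepsModPiPrime_image_mul hφ s) hs (isStableUnder_image_mul hs s)]
  have hconj : D.act D.conj y = -y := by
    rw [hy, D.act_conj_yPointChi hθ' h2,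
      sum_const_eq_zero_of_stable hB2 hB1 hs (by rw [← two_nsmul]; exact two_nsmul_ptOne), add_zero,
      D.yPointChi_eq_of_isReps_of_isStableUnder hθ' hπθ' h3 hπ hB2 hB1 hφ (D.isRepsModPiPrime_image_inv hπ hφ) hs
      (isStableUnder_image_inv hB2 hs)]
  -- the generators lie in the twist stabiliser, hence so does `Gal(H/K)`
  have hle : Subgroup.closure (Set.range D.art ∪ {D.tau}) ≤ D.twistStabilizer hθ' hθ'0 y := by
    rw [Subgroup.closure_le]
    rintro σ (⟨s, rfl⟩ | hσ')
    · refine ⟨fun h => ?_, fun h => ?_⟩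
      · rw [hσ s]; unfold chi; rw [if_pos h, one_zsmul]
      · rw [hσ s]; unfold chi; rw [if_neg (by rw [h]; exact hne), neg_one_zsmul]
    · rw [Set.mem_singleton_iff] at hσ'
      rw [hσ']
      exact ⟨fun _ => htau, fun h => absurd (hτθ'.symm.trans h) hne.symm⟩
  have hfix : ∀ g : D.H ≃ₐ[ℚ] D.H, g θ' = θ' → D.act g y = y := by
    intro g hg
    rcases D.gal_theta'_eq_or_eq_neg D.sqrtNegTwoN_sq' g with hgθ | hgθ
    · exact (hle (hgalK g hgθ)).1 hg
    · have h' : (D.conj * g) D.sqrtNegTwoN = D.sqrtNegTwoN := by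
        rw [AlgEquiv.mul_apply, hgθ, map_neg, hconjθ, neg_neg]
      have h'' : (D.conj * g) θ' = -θ' := by rw [AlgEquiv.mul_apply, hg, hcθ']
      have := (hle (hgalK _ h')).2 h''
      rw [D.act_mul] at this
      have h3' := congrArg (D.act D.conj) this
      rw [← D.act_mul, hconj2, D.act_one, map_neg, hconj, neg_neg] at h3'
      exact h3'
  have hneg : ∀ g : D.H ≃ₐ[ℚ] D.H, g θ' = -θ' → D.act g y = -y := by
    intro g hg
    rcases D.gal_theta'_eq_or_eq_neg D.sqrtNegTwoN_sq' g with hgθ | hgθ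
    · exact (hle (hgalK g hgθ)).2 hg
    · have h' : (D.conj * g) D.sqrtNegTwoN = D.sqrtNegTwoN := by
        rw [AlgEquiv.mul_apply, hgθ, map_neg, hconjθ, neg_neg]
      have h'' : (D.conj * g) θ' = θ' := by rw [AlgEquiv.mul_apply, hg, map_neg, hcθ', neg_neg]
      have := (hle (hgalK _ h')).1 h''
      rw [D.act_mul] at this
      have h3' := congrArg (D.act D.conj) this
      rw [← D.act_mul, hconj2, D.act_one, hconj] at h3'
      exact h3'
  exact exists_transferE_eq_of_forall_gal d θ' hθ'd hθ'0 y hfix hneg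

end TwistDescent

/-- An odd multiple of a `2`-torsion point is the point itself. [cite: Monsky1990MockHeegner, Thm. 5.5 proof (p. 62: "G² contains an odd number of classes. So R^σ − R = Σ_{G²}(−1,1) = (−1,1)")] [folklore] -/
theorem odd_nsmul_of_two_nsmul_eq_zero {M : Type*} [AddCommGroup M] {ε : M} (hε : (2 : ℕ) • ε = 0) {k : ℕ}
    (hk : Odd k) : k • ε = ε := by
  obtain ⟨m, rfl⟩ := hk
  rw [add_nsmul, mul_nsmul, hε, smul_zero, zero_add, one_nsmul]

section SignedAnyTransversal

variable (D : CMPointData n) {θ' : D.H} (hθ'0 : θ' ≠ 0)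

/-- **Monsky Thm. 4.7 for the twist by `θ′`, signed sums, EVERY transversal** (Remark p. 57: changing `φ` moves
`S_{N,φ}` by `T ⊂ Λ_N`). [cite: Monsky1990MockHeegner, Thm. 4.7 and the Remark (p. 57)] -/
theorem exists_transferE_eq_yPointChi (hP : D.Printed) (d : ℕ) (hd : d ≠ 0)
    (hθ'd : θ' ^ 2 = algebraMap ℚ D.H (-(d : ℚ))) (hπθ' : D.art D.piPrime θ' = θ') (hτθ' : D.tau θ' = θ')
    (hcθ' : D.conj θ' = -θ') {B : ClassGroup (𝓞 (GenusField (2 * n)))} (hB2 : B * B = 1) (hB1 : B ≠ 1)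
    (hBπ : B ≠ D.piPrime) {φ : Finset (ClassGroup (𝓞 (GenusField (2 * n))))} (hφ : D.IsRepsModPiPrime φ) :
    ∃ y' : (congruentNumberCurve d).toAffine.Point, transferE d θ' hθ'd hθ'0 y' = D.yPointChi θ' φ := by
  classical
  have hP' := hP
  obtain ⟨-, -, h3, -, -, -, -, -, -, hπ, hπ1⟩ := hP'
  obtain ⟨φ₀, hφ₀, hs₀⟩ := exists_isReps_isStableUnder D.piPrime B hπ hπ1 hB2 hB1 hBπ
  obtain ⟨y₀, hy₀⟩ := D.exists_transferE_eq_yPointChi_of_isStableUnder hθ'd hθ'0 hP d hθ'd hπθ' hτθ' hcθ'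
    hB2 hB1 hφ₀ hs₀
  set ε₀ : (congruentNumberCurve d).toAffine.Point :=
    if n % 8 = 7 then twoTorsionNegN d hd else twoTorsionPosN d hd with hε₀
  have hε : transferE d θ' hθ'd hθ'0 ε₀ = (if n % 8 = 7 then ptOne else ptNegOne : EPoint D.H) := by
    rw [hε₀]; split_ifs
    · exact transferE_twoTorsionNegN d hd _ _ _
    · exact transferE_twoTorsionPosN d hd _ _ _
  refine ⟨y₀ + (φ₀.filter fun t => t ∉ φ).card • ε₀, ?_⟩
  rw [map_add, map_nsmul, hy₀, hε, D.yPointChi_eq_add_sum_of_isReps hθ'd hπθ' h3 hπ hφ₀ hφ, Finset.sum_const]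

end SignedAnyTransversal


end CMPointData


end Literature.NumberTheory.EllipticCurves.Tian2014

end
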